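import Summits.QuantumFields.YangMills.Theorems.ColdStartUniversalityLatticeLangevinLiebRobinsonCorrelationLightConePointwise
import Summits.QuantumFields.YangMills.Theorems.ColdStartUniversalityLatticeLangevinLiebRobinsonPlaquetteCovarianceSum
import Summits.QuantumFields.YangMills.Theorems.ColdStartUniversalityLatticeLangevinGeneratorFrameForm
import Summits.QuantumFields.YangMills.Theorems.ColdStartUniversalityLatticeLangevinWilsonFrameIBP
import HarnessLib

/-!
# Route `ColdStartUniversality` (fixed-cut-off SZZ dynamics; LIEB–ROBINSON / LOCALITY package, file 39):
# THE COUPLING ENTERS THE GENERATOR LOCALLY — `|𝓛_(β₁)f − 𝓛_(β₂)f| ≤ 2304π·|β₁ − β₂|·Σ_e ℓ^f_e`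

Helper file (seat `ym-line-csu-p1`, g32; `--supports stmt-QuantumFields-24809`).  Static input of the COUPLING LIGHT CONE (file 40: the cold-start
expectation of a local observable is Lipschitz in the coupling `β'`, uniformly in the volume).  For the `SU(2)` SZZ generators on `(ℤ/L)³`:
* `card_plaquettes_through_le` — at most `36` plaquette words pass through a given link (crude: base site within a unit step, `≤ 9` planes);
* ★ `abs_wilsonAction_sub_le` — the Wilson action `S_W = Σ_p (2 − Re tr U_p)` is `288π`-Lipschitz in EACH link (Frobenius distance, other links
  frozen), although it has `3L³` terms (`wilsonAction_eq_sum_word` + the word profiles `word_linkLipschitz_profile`);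
* ★ `abs_psiHat_sub_psiHat_sub_le` — hence the density exponents `ψ̂_b = 2b#𝒫 − b·S_W` (`neg_mul_wilsonAction_eq_psiHat`) satisfy
  `|(ψ̂_(b₁) − ψ̂_(b₂))(coords y) − (ψ̂_(b₁) − ψ̂_(b₂))(coords y')| ≤ 288π|b₁ − b₂|·‖y_e − y'_e‖_F`;
* ★★ `abs_generator_sub_generator_le` — for every `C²` `f` whose pull-back has the link-Lipschitz profile `ℓ ≥ 0` and every configuration `V`:
  `|𝓛_(β₁)f(V) − 𝓛_(β₂)f(V)| ≤ 2304π·|β₁ − β₂|·Σ_e ℓ_e` — by the frame form of the generator (`generator_eq_half_frameGen`: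
  `𝓛_β f = ½Σ_n (W_nW_n f + W_nψ̂_β·W_n f)`; the second-order part does not see `β`), `W_n(ψ̂_(β₁) − ψ̂_(β₂)) ≤ √2·288π|β₁−β₂|` and
  `|W_n f| ≤ √2 ℓ_(n.1)` (`frameDeriv_abs_le_of_linkLipschitz`), `8` noise directions per link.  Only links where `f` varies contribute: the
  coupling acts on a local observable LOCALLY, with a volume-free constant.
THEOREMS ONLY, no definition, no sorry; [folklore] / [cite: ShenZhuZhu2022, §3 Lemma 3.1].  HONEST FRAMING: fixed cut-off, pure bookkeeping at
every coupling; nothing `K`-uniform; `UniformColdStartMixing` (24809) is NOT restated; no crux, rung or summit statement is proved; the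
Yang–Mills mass gap is NOT proved.
-/

set_option autoImplicit false

noncomputable section

namespace Summit.QuantumFields.YangMills.Theorems.ColdStartUniversality.LiebRobinson

open MeasureTheory ProbabilityTheory Matrix Complex Finset Filter Set Metric
open scoped ComplexConjugate BigOperators Matrix NNReal ENNReal Topology
open Literature.Probability.Process Literature.MathematicalPhysics.QuantumFieldTheory
open Literature.MathematicalPhysics.QuantumFieldTheory.Balaban1983to89
open Literature.MathematicalPhysics.QuantumLattice (fundamentalRep fundamentalLatticeRep continuous_fundamentalRep fundamentalRep_apply)

variable {L : ℕ} [NeZero L]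

/-! ## §1. Plaquettes through a link -/

/-- **At most `36` plaquette words pass through a link** (the base site of such a plaquette is the base site of the link or one unit step
below it: `≤ 4` sites, `≤ 9` plane labels). [folklore] -/
theorem card_plaquettes_through_le (e : Edge 3 L) :
    (Finset.univ.filter fun p : Plaquette 3 L => e ∈ ([((p.1, p.2.1.1), false), ((Literature.MathematicalPhysics.QuantumFieldTheory.Site.shift p.1 p.2.1.1, p.2.1.2), false), ((Literature.MathematicalPhysics.QuantumFieldTheory.Site.shift p.1 p.2.1.2, p.2.1.1), true), ((p.1, p.2.1.2), true)].map Prod.fst).toFinset).card ≤ 36 := by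
  classical
  set S : Finset (Literature.MathematicalPhysics.QuantumFieldTheory.Site 3 L) := insert e.1 (Finset.univ.image fun i : Fin 3 => e.1 - Pi.single i 1) with hS
  have hScard : S.card ≤ 4 := by
    refine (Finset.card_insert_le _ _).trans ?_
    have h := Finset.card_image_le (s := (Finset.univ : Finset (Fin 3))) (f := fun i : Fin 3 => e.1 - Pi.single i 1)
    rw [Finset.card_univ, Fintype.card_fin] at h
    omega
  have hsub : (Finset.univ.filter fun p : Plaquette 3 L => e ∈ ([((p.1, p.2.1.1), false), ((Literature.MathematicalPhysics.QuantumFieldTheory.Site.shift p.1 p.2.1.1, p.2.1.2), false), ((Literature.MathematicalPhysics.QuantumFieldTheory.Site.shift p.1 p.2.1.2, p.2.1.1), true), ((p.1, p.2.1.2), true)].map Prod.fst).toFinset) ⊆ S ×ˢ Finset.univ := by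
    intro p hp
    rw [Finset.mem_filter] at hp
    have he := hp.2
    simp only [List.map, List.mem_toFinset, List.mem_cons, List.not_mem_nil, or_false] at he
    rw [Finset.mem_product]
    refine ⟨?_, Finset.mem_univ _⟩
    have hshift : ∀ i : Fin 3, Literature.MathematicalPhysics.QuantumFieldTheory.Site.shift p.1 i = p.1 + Pi.single i 1 := fun i => rfl
    rcases he with h | h | h | h
    · rw [hS, h]; exact Finset.mem_insert_self _ _
    · rw [hS, h, hshift]
      refine Finset.mem_insert_of_mem (Finset.mem_image.2 ⟨p.2.1.1, Finset.mem_univ _, ?_⟩)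
      simp
    · rw [hS, h, hshift]
      refine Finset.mem_insert_of_mem (Finset.mem_image.2 ⟨p.2.1.2, Finset.mem_univ _, ?_⟩)
      simp
    · rw [hS, h]; exact Finset.mem_insert_self _ _
  have hplanes : (Finset.univ : Finset {q : Fin 3 × Fin 3 // q.1 < q.2}).card ≤ 9 := by
    rw [Finset.card_univ]
    exact (Fintype.card_subtype_le _).trans (by simp)
  calc (Finset.univ.filter fun p : Plaquette 3 L => e ∈ ([((p.1, p.2.1.1), false), ((Literature.MathematicalPhysics.QuantumFieldTheory.Site.shift p.1 p.2.1.1, p.2.1.2), false), ((Literature.MathematicalPhysics.QuantumFieldTheory.Site.shift p.1 p.2.1.2, p.2.1.1), true), ((p.1, p.2.1.2), true)].map Prod.fst).toFinset).card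
      ≤ (S ×ˢ (Finset.univ : Finset {q : Fin 3 × Fin 3 // q.1 < q.2})).card := Finset.card_le_card hsub
    _ = S.card * (Finset.univ : Finset {q : Fin 3 × Fin 3 // q.1 < q.2}).card := Finset.card_product _ _
    _ ≤ 4 * 9 := Nat.mul_le_mul hScard hplanes
    _ = 36 := by norm_num

/-! ## §2. The Wilson action and the density exponent are Lipschitz in each link -/

/-- ★ **The Wilson action is `288π`-Lipschitz in each link** (Frobenius distance of the link matrices, all other links frozen), for every
torus size: `S_W = Σ_p (2 − Re tr w_p)` (`wilsonAction_eq_sum_word`), each plaquette word is `8π`-Lipschitz in its links (`word_linkLipschitz_profile`)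
and at most `36` plaquettes pass through a link. [folklore] -/
theorem abs_wilsonAction_sub_le (e : Edge 3 L) (y y' : (GaugeConfig 3 L (Matrix.specialUnitaryGroup (Fin 2) ℂ))) (hyy' : ∀ f', f' ≠ e → y f' = y' f') :
    |wilsonAction (fundamentalRep (Fin 2)) y - wilsonAction (fundamentalRep (Fin 2)) y'| ≤
      288 * Real.pi * frobNorm ((y e : Matrix (Fin 2) (Fin 2) ℂ) - (y' e : Matrix (Fin 2) (Fin 2) ℂ)) := by
  classical
  set coords : GaugeConfig 3 L (Matrix.specialUnitaryGroup (Fin 2) ℂ) → (Edge 3 L × Fin 2 × Fin 2 × Bool → ℝ) :=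
    fun V q => (fun z : ℂ => if q.2.2.2 then z.im else z.re) ((fundamentalRep (Fin 2) (V q.1) : Matrix (Fin 2) (Fin 2) ℂ) q.2.1 q.2.2.1) with hcoords
  set d : ℝ := frobNorm ((y e : Matrix (Fin 2) (Fin 2) ℂ) - (y' e : Matrix (Fin 2) (Fin 2) ℂ)) with hd
  have hd0 : 0 ≤ d := frobNorm_nonneg _
  have hS : ∀ x : (GaugeConfig 3 L (Matrix.specialUnitaryGroup (Fin 2) ℂ)), wilsonAction (fundamentalRep (Fin 2)) x = ∑ p : Plaquette 3 L, (2 - (fun y : (Edge 3 L × Fin 2 × Fin 2 × Bool → ℝ) => (([((p.1, p.2.1.1), false), ((Literature.MathematicalPhysics.QuantumFieldTheory.Site.shift p.1 p.2.1.1, p.2.1.2), false), ((Literature.MathematicalPhysics.QuantumFieldTheory.Site.shift p.1 p.2.1.2, p.2.1.1), true), ((p.1, p.2.1.2), true)].map (fun a : Edge 3 L × Bool => if a.2 then ((fun (ee : Edge 3 L) => Matrix.of fun (i j : Fin 2) => ((y (ee, i, j, false) : ℝ) : ℂ) + ((y (ee, i, j, true) : ℝ) : ℂ) * Complex.I) a.1)ᴴ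 else (fun (ee : Edge 3 L) => Matrix.of fun (i j : Fin 2) => ((y (ee, i, j, false) : ℝ) : ℂ) + ((y (ee, i, j, true) : ℝ) : ℂ) * Complex.I) a.1)).prod).trace.re) (coords x)) :=
    fun x => wilsonAction_eq_sum_word (L := L) x
  -- per-plaquette Lipschitz bound at the link `e`
  have hP : ∀ p : Plaquette 3 L, |(fun y : (Edge 3 L × Fin 2 × Fin 2 × Bool → ℝ) => (([((p.1, p.2.1.1), false), ((Literature.MathematicalPhysics.QuantumFieldTheory.Site.shift p.1 p.2.1.1, p.2.1.2), false), ((Literature.MathematicalPhysics.QuantumFieldTheory.Site.shift p.1 p.2.1.2, p.2.1.1), true), ((p.1, p.2.1.2), true)].map (fun a : Edge 3 L × Bool => if a.2 then ((fun (ee : Edge 3 L) => Matrix.of fun (i j : Fin 2) => ((y (ee, i, j, false) : ℝ) : ℂ) + ((y (ee, i, j, true) : ℝ) : ℂ) * Complex.I) a.1)ᴴ else (fun (ee : Edge 3 L) => Matrix.of fun (i j : Fin 2) => ((y (ee, i, j, false) : ℝ) : ℂ) + ((y (ee, i, j, true) : ℝ) : ℂ) * Complex.I) a.1)).prod).trace.re)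 (coords y) - (fun y : (Edge 3 L × Fin 2 × Fin 2 × Bool → ℝ) => (([((p.1, p.2.1.1), false), ((Literature.MathematicalPhysics.QuantumFieldTheory.Site.shift p.1 p.2.1.1, p.2.1.2), false), ((Literature.MathematicalPhysics.QuantumFieldTheory.Site.shift p.1 p.2.1.2, p.2.1.1), true), ((p.1, p.2.1.2), true)].map (fun a : Edge 3 L × Bool => if a.2 then ((fun (ee : Edge 3 L) => Matrix.of fun (i j : Fin 2) => ((y (ee, i, j, false) : ℝ) : ℂ) + ((y (ee, i, j, true) : ℝ) : ℂ) * Complex.I) a.1)ᴴ else (fun (ee : Edge 3 L) => Matrix.of fun (i j : Fin 2) => ((y (ee, i, j, false) : ℝ) : ℂ) + ((y (ee, i, j, true) : ℝ) : ℂ) * Complex.I) a.1)).prod).trace.re) (coords y')| ≤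
      (if e ∈ ([((p.1, p.2.1.1), false), ((Literature.MathematicalPhysics.QuantumFieldTheory.Site.shift p.1 p.2.1.1, p.2.1.2), false), ((Literature.MathematicalPhysics.QuantumFieldTheory.Site.shift p.1 p.2.1.2, p.2.1.1), true), ((p.1, p.2.1.2), true)].map Prod.fst).toFinset then 2 * Real.pi * (4 : ℕ) else 0) * d := by
    intro p
    have h := word_linkLipschitz_profile L (0 : ℝ) [((p.1, p.2.1.1), false), ((Literature.MathematicalPhysics.QuantumFieldTheory.Site.shift p.1 p.2.1.1, p.2.1.2), false), ((Literature.MathematicalPhysics.QuantumFieldTheory.Site.shift p.1 p.2.1.2, p.2.1.1), true), ((p.1, p.2.1.2), true)] e y y' hyy'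
    exact h
  rw [hS y, hS y']
  have hdiff : (∑ p : Plaquette 3 L, (2 - (fun y : (Edge 3 L × Fin 2 × Fin 2 × Bool → ℝ) => (([((p.1, p.2.1.1), false), ((Literature.MathematicalPhysics.QuantumFieldTheory.Site.shift p.1 p.2.1.1, p.2.1.2), false), ((Literature.MathematicalPhysics.QuantumFieldTheory.Site.shift p.1 p.2.1.2, p.2.1.1), true), ((p.1, p.2.1.2), true)].map (fun a : Edge 3 L × Bool => if a.2 then ((fun (ee : Edge 3 L) => Matrix.of fun (i j : Fin 2) => ((y (ee, i, j, false) : ℝ) : ℂ) + ((y (ee, i, j, true) : ℝ) : ℂ) * Complex.I) a.1)ᴴ else (fun (ee : Edge 3 L) => Matrix.of fun (i j : Fin 2) => ((y (ee, i, j, false) : ℝ) : ℂ) + ((y (ee, i, j, true) : ℝ) : ℂ) * Complex.I) a.1)).prod).trace.re) (coords y))) - ∑ p : Plaquette 3 L, (2 - (fun y : (Edge 3 L × Fin 2 × Fin 2 × Bool → ℝ) => (([((p.1, p.2.1.1), false), ((Literature.MathematicalPhysics.QuantumFieldTheory.Site.shift p.1 p.2.1.1, p.2.1.2), false), ((Literature.MathematicalPhysics.QuantumFieldTheory.Site.shift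 p.1 p.2.1.2, p.2.1.1), true), ((p.1, p.2.1.2), true)].map (fun a : Edge 3 L × Bool => if a.2 then ((fun (ee : Edge 3 L) => Matrix.of fun (i j : Fin 2) => ((y (ee, i, j, false) : ℝ) : ℂ) + ((y (ee, i, j, true) : ℝ) : ℂ) * Complex.I) a.1)ᴴ else (fun (ee : Edge 3 L) => Matrix.of fun (i j : Fin 2) => ((y (ee, i, j, false) : ℝ) : ℂ) + ((y (ee, i, j, true) : ℝ) : ℂ) * Complex.I) a.1)).prod).trace.re) (coords y')) =
      ∑ p : Plaquette 3 L, ((fun y : (Edge 3 L × Fin 2 × Fin 2 × Bool → ℝ) => (([((p.1, p.2.1.1), false), ((Literature.MathematicalPhysics.QuantumFieldTheory.Site.shift p.1 p.2.1.1, p.2.1.2), false), ((Literature.MathematicalPhysics.QuantumFieldTheory.Site.shift p.1 p.2.1.2, p.2.1.1), true), ((p.1, p.2.1.2), true)].map (fun a : Edge 3 L × Bool => if a.2 then ((fun (ee : Edge 3 L) => Matrix.of fun (i j : Fin 2) => ((y (ee, i, j, false) : ℝ) : ℂ) + ((y (ee, i, j, true) : ℝ) : ℂ) * Complex.I) a.1)ᴴ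 else (fun (ee : Edge 3 L) => Matrix.of fun (i j : Fin 2) => ((y (ee, i, j, false) : ℝ) : ℂ) + ((y (ee, i, j, true) : ℝ) : ℂ) * Complex.I) a.1)).prod).trace.re) (coords y') - (fun y : (Edge 3 L × Fin 2 × Fin 2 × Bool → ℝ) => (([((p.1, p.2.1.1), false), ((Literature.MathematicalPhysics.QuantumFieldTheory.Site.shift p.1 p.2.1.1, p.2.1.2), false), ((Literature.MathematicalPhysics.QuantumFieldTheory.Site.shift p.1 p.2.1.2, p.2.1.1), true), ((p.1, p.2.1.2), true)].map (fun a : Edge 3 L × Bool => if a.2 then ((fun (ee : Edge 3 L) => Matrix.of fun (i j : Fin 2) => ((y (ee, i, j, false) : ℝ) : ℂ) + ((y (ee, i, j, true) : ℝ) : ℂ) * Complex.I) a.1)ᴴ else (fun (ee : Edge 3 L) => Matrix.of fun (i j : Fin 2) => ((y (ee, i, j, false) : ℝ) : ℂ) + ((y (ee, i, j, true) : ℝ) : ℂ) * Complex.I) a.1)).prod).trace.re) (coords y)) := by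
    rw [← Finset.sum_sub_distrib]; exact Finset.sum_congr rfl fun p _ => by ring
  rw [hdiff]
  refine (Finset.abs_sum_le_sum_abs _ _).trans ?_
  calc ∑ p : Plaquette 3 L, |(fun y : (Edge 3 L × Fin 2 × Fin 2 × Bool → ℝ) => (([((p.1, p.2.1.1), false), ((Literature.MathematicalPhysics.QuantumFieldTheory.Site.shift p.1 p.2.1.1, p.2.1.2), false), ((Literature.MathematicalPhysics.QuantumFieldTheory.Site.shift p.1 p.2.1.2, p.2.1.1), true), ((p.1, p.2.1.2), true)].map (fun a : Edge 3 L × Bool => if a.2 then ((fun (ee : Edge 3 L) => Matrix.of fun (i j : Fin 2) => ((y (ee, i, j, false) : ℝ) : ℂ) + ((y (ee, i, j, true) : ℝ) : ℂ) * Complex.I) a.1)ᴴ else (fun (ee : Edge 3 L) => Matrix.of fun (i j : Fin 2) => ((y (ee, i, j, false) : ℝ) : ℂ) + ((y (ee, i, j, true) : ℝ) : ℂ) * Complex.I) a.1)).prod).trace.re) (coords y') - (fun y : (Edge 3 L × Fin 2 × Fin 2 × Bool → ℝ) => (([((p.1, p.2.1.1), false), ((Literature.MathematicalPhysics.QuantumFieldTheory.Site.shift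 p.1 p.2.1.1, p.2.1.2), false), ((Literature.MathematicalPhysics.QuantumFieldTheory.Site.shift p.1 p.2.1.2, p.2.1.1), true), ((p.1, p.2.1.2), true)].map (fun a : Edge 3 L × Bool => if a.2 then ((fun (ee : Edge 3 L) => Matrix.of fun (i j : Fin 2) => ((y (ee, i, j, false) : ℝ) : ℂ) + ((y (ee, i, j, true) : ℝ) : ℂ) * Complex.I) a.1)ᴴ else (fun (ee : Edge 3 L) => Matrix.of fun (i j : Fin 2) => ((y (ee, i, j, false) : ℝ) : ℂ) + ((y (ee, i, j, true) : ℝ) : ℂ) * Complex.I) a.1)).prod).trace.re) (coords y)|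
      ≤ ∑ p : Plaquette 3 L, (if e ∈ ([((p.1, p.2.1.1), false), ((Literature.MathematicalPhysics.QuantumFieldTheory.Site.shift p.1 p.2.1.1, p.2.1.2), false), ((Literature.MathematicalPhysics.QuantumFieldTheory.Site.shift p.1 p.2.1.2, p.2.1.1), true), ((p.1, p.2.1.2), true)].map Prod.fst).toFinset then 2 * Real.pi * (4 : ℕ) else 0) * d :=
        Finset.sum_le_sum fun p _ => by rw [abs_sub_comm]; exact hP p
    _ = ((Finset.univ.filter fun p : Plaquette 3 L => e ∈ ([((p.1, p.2.1.1), false), ((Literature.MathematicalPhysics.QuantumFieldTheory.Site.shift p.1 p.2.1.1, p.2.1.2), false), ((Literature.MathematicalPhysics.QuantumFieldTheory.Site.shift p.1 p.2.1.2, p.2.1.1), true), ((p.1, p.2.1.2), true)].map Prod.fst).toFinset).card : ℝ) * (2 * Real.pi * (4 : ℕ) * d) := by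
        rw [← Finset.sum_mul, Finset.sum_ite, Finset.sum_const_zero, add_zero, Finset.sum_const, nsmul_eq_mul]
        ring
    _ ≤ 36 * (2 * Real.pi * (4 : ℕ) * d) := by
        have h36 : ((Finset.univ.filter fun p : Plaquette 3 L => e ∈ ([((p.1, p.2.1.1), false), ((Literature.MathematicalPhysics.QuantumFieldTheory.Site.shift p.1 p.2.1.1, p.2.1.2), false), ((Literature.MathematicalPhysics.QuantumFieldTheory.Site.shift p.1 p.2.1.2, p.2.1.1), true), ((p.1, p.2.1.2), true)].map Prod.fst).toFinset).card : ℝ) ≤ 36 := by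
          exact_mod_cast card_plaquettes_through_le (L := L) e
        exact mul_le_mul_of_nonneg_right h36 (by positivity)
    _ = 288 * Real.pi * d := by push_cast; ring

/-- ★ **The difference of two density exponents is `288π|b₁ − b₂|`-Lipschitz in each link**: with `ψ̂_b = b·Σ_p Re tr U_p` (so that
`ψ̂_b(coords V) = 2b#𝒫 − b·S_W(V)`, `neg_mul_wilsonAction_eq_psiHat`), for configurations `y, y'` differing only at the link `e`:
`|(ψ̂_(b₁) − ψ̂_(b₂))(coords y) − (ψ̂_(b₁) − ψ̂_(b₂))(coords y')| ≤ 288π·|b₁ − b₂|·‖y_e − y'_e‖_F`. [folklore] -/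
theorem abs_psiHat_sub_psiHat_sub_le (b₁ b₂ : ℝ) (e : Edge 3 L) (y y' : (GaugeConfig 3 L (Matrix.specialUnitaryGroup (Fin 2) ℂ))) (hyy' : ∀ f', f' ≠ e → y f' = y' f') :
    let coords : GaugeConfig 3 L (Matrix.specialUnitaryGroup (Fin 2) ℂ) → (Edge 3 L × Fin 2 × Fin 2 × Bool → ℝ) :=
      fun V q => (fun z : ℂ => if q.2.2.2 then z.im else z.re)
        ((fundamentalRep (Fin 2) (V q.1) : Matrix (Fin 2) (Fin 2) ℂ) q.2.1 q.2.2.1)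
    |((fun y : (Edge 3 L × Fin (fundamentalLatticeRep 2).N × Fin (fundamentalLatticeRep 2).N × Bool → ℝ) => b₁ * ∑ p : Plaquette 3 L, (rootedLoop (fun (ee : Edge 3 L) (i j : Fin (fundamentalLatticeRep 2).N) => ((y (ee, i, j, false) : ℝ) : ℂ) + ((y (ee, i, j, true) : ℝ) : ℂ) * Complex.I) (p.1, p.2.1.1) p.2.1.2 false).trace.re) (coords y) - (fun y : (Edge 3 L × Fin (fundamentalLatticeRep 2).N × Fin (fundamentalLatticeRep 2).N × Bool → ℝ) => b₂ * ∑ p : Plaquette 3 L, (rootedLoop (fun (ee : Edge 3 L) (i j : Fin (fundamentalLatticeRep 2).N) => ((y (ee, i, j, false) : ℝ) : ℂ) + ((y (ee, i, j, true) : ℝ) : ℂ) * Complex.I) (p.1, p.2.1.1) p.2.1.2 false).trace.re) (coords y)) - ((fun y : (Edge 3 L × Fin (fundamentalLatticeRep 2).N × Fin (fundamentalLatticeRep 2).N × Bool → ℝ) => b₁ * ∑ p : Plaquette 3 L, (rootedLoop (fun (ee : Edge 3 L) (i j : Fin (fundamentalLatticeRep 2).N) => ((y (ee, i, j, false) : ℝ)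 : ℂ) + ((y (ee, i, j, true) : ℝ) : ℂ) * Complex.I) (p.1, p.2.1.1) p.2.1.2 false).trace.re) (coords y') - (fun y : (Edge 3 L × Fin (fundamentalLatticeRep 2).N × Fin (fundamentalLatticeRep 2).N × Bool → ℝ) => b₂ * ∑ p : Plaquette 3 L, (rootedLoop (fun (ee : Edge 3 L) (i j : Fin (fundamentalLatticeRep 2).N) => ((y (ee, i, j, false) : ℝ) : ℂ) + ((y (ee, i, j, true) : ℝ) : ℂ) * Complex.I) (p.1, p.2.1.1) p.2.1.2 false).trace.re) (coords y'))| ≤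
      288 * Real.pi * |b₁ - b₂| * frobNorm ((y e : Matrix (Fin 2) (Fin 2) ℂ) - (y' e : Matrix (Fin 2) (Fin 2) ℂ)) := by
  intro coords
  have h1 : -b₁ * wilsonAction (fundamentalRep (Fin 2)) y = (fun y : (Edge 3 L × Fin (fundamentalLatticeRep 2).N × Fin (fundamentalLatticeRep 2).N × Bool → ℝ) => b₁ * ∑ p : Plaquette 3 L, (rootedLoop (fun (ee : Edge 3 L) (i j : Fin (fundamentalLatticeRep 2).N) => ((y (ee, i, j, false) : ℝ) : ℂ) + ((y (ee, i, j, true) : ℝ) : ℂ) * Complex.I) (p.1, p.2.1.1) p.2.1.2 false).trace.re) (coords y) - 2 * b₁ * (Fintype.card (Plaquette 3 L) : ℝ) :=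
    neg_mul_wilsonAction_eq_psiHat (L := L) b₁ y
  have h2 : -b₂ * wilsonAction (fundamentalRep (Fin 2)) y = (fun y : (Edge 3 L × Fin (fundamentalLatticeRep 2).N × Fin (fundamentalLatticeRep 2).N × Bool → ℝ) => b₂ * ∑ p : Plaquette 3 L, (rootedLoop (fun (ee : Edge 3 L) (i j : Fin (fundamentalLatticeRep 2).N) => ((y (ee, i, j, false) : ℝ) : ℂ) + ((y (ee, i, j, true) : ℝ) : ℂ) * Complex.I) (p.1, p.2.1.1) p.2.1.2 false).trace.re) (coords y) - 2 * b₂ * (Fintype.card (Plaquette 3 L) : ℝ) :=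
    neg_mul_wilsonAction_eq_psiHat (L := L) b₂ y
  have h1' : -b₁ * wilsonAction (fundamentalRep (Fin 2)) y' = (fun y : (Edge 3 L × Fin (fundamentalLatticeRep 2).N × Fin (fundamentalLatticeRep 2).N × Bool → ℝ) => b₁ * ∑ p : Plaquette 3 L, (rootedLoop (fun (ee : Edge 3 L) (i j : Fin (fundamentalLatticeRep 2).N) => ((y (ee, i, j, false) : ℝ) : ℂ) + ((y (ee, i, j, true) : ℝ) : ℂ) * Complex.I) (p.1, p.2.1.1) p.2.1.2 false).trace.re) (coords y') - 2 * b₁ * (Fintype.card (Plaquette 3 L) : ℝ) :=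
    neg_mul_wilsonAction_eq_psiHat (L := L) b₁ y'
  have h2' : -b₂ * wilsonAction (fundamentalRep (Fin 2)) y' = (fun y : (Edge 3 L × Fin (fundamentalLatticeRep 2).N × Fin (fundamentalLatticeRep 2).N × Bool → ℝ) => b₂ * ∑ p : Plaquette 3 L, (rootedLoop (fun (ee : Edge 3 L) (i j : Fin (fundamentalLatticeRep 2).N) => ((y (ee, i, j, false) : ℝ) : ℂ) + ((y (ee, i, j, true) : ℝ) : ℂ) * Complex.I) (p.1, p.2.1.1) p.2.1.2 false).trace.re) (coords y') - 2 * b₂ * (Fintype.card (Plaquette 3 L) : ℝ) :=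
    neg_mul_wilsonAction_eq_psiHat (L := L) b₂ y'
  beta_reduce at h1 h2 h1' h2'
  have hS := abs_wilsonAction_sub_le (L := L) e y y' hyy'
  have e1 : ((fun y : (Edge 3 L × Fin (fundamentalLatticeRep 2).N × Fin (fundamentalLatticeRep 2).N × Bool → ℝ) => b₁ * ∑ p : Plaquette 3 L, (rootedLoop (fun (ee : Edge 3 L) (i j : Fin (fundamentalLatticeRep 2).N) => ((y (ee, i, j, false) : ℝ) : ℂ) + ((y (ee, i, j, true) : ℝ) : ℂ) * Complex.I) (p.1, p.2.1.1) p.2.1.2 false).trace.re) (coords y) - (fun y : (Edge 3 L × Fin (fundamentalLatticeRep 2).N × Fin (fundamentalLatticeRep 2).N × Bool → ℝ) => b₂ * ∑ p : Plaquette 3 L, (rootedLoop (fun (ee : Edge 3 L) (i j : Fin (fundamentalLatticeRep 2).N) => ((y (ee, i, j, false) : ℝ) : ℂ) + ((y (ee, i, j, true) : ℝ) : ℂ) * Complex.I) (p.1, p.2.1.1) p.2.1.2 false).trace.re) (coords y)) - ((fun y : (Edge 3 L × Fin (fundamentalLatticeRep 2).N × Fin (fundamentalLatticeRep 2).N ×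 Bool → ℝ) => b₁ * ∑ p : Plaquette 3 L, (rootedLoop (fun (ee : Edge 3 L) (i j : Fin (fundamentalLatticeRep 2).N) => ((y (ee, i, j, false) : ℝ) : ℂ) + ((y (ee, i, j, true) : ℝ) : ℂ) * Complex.I) (p.1, p.2.1.1) p.2.1.2 false).trace.re) (coords y') - (fun y : (Edge 3 L × Fin (fundamentalLatticeRep 2).N × Fin (fundamentalLatticeRep 2).N × Bool → ℝ) => b₂ * ∑ p : Plaquette 3 L, (rootedLoop (fun (ee : Edge 3 L) (i j : Fin (fundamentalLatticeRep 2).N) => ((y (ee, i, j, false) : ℝ) : ℂ) + ((y (ee, i, j, true) : ℝ) : ℂ) * Complex.I) (p.1, p.2.1.1) p.2.1.2 false).trace.re) (coords y')) =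
      -(b₁ - b₂) * (wilsonAction (fundamentalRep (Fin 2)) y - wilsonAction (fundamentalRep (Fin 2)) y') := by
    beta_reduce; linarith
  rw [e1, abs_mul, abs_neg]
  calc |b₁ - b₂| * |wilsonAction (fundamentalRep (Fin 2)) y - wilsonAction (fundamentalRep (Fin 2)) y'|
      ≤ |b₁ - b₂| * (288 * Real.pi * frobNorm ((y e : Matrix (Fin 2) (Fin 2) ℂ) - (y' e : Matrix (Fin 2) (Fin 2) ℂ))) :=
        mul_le_mul_of_nonneg_left hS (abs_nonneg _)
    _ = _ := by ring

/-! ## §3. The generators at two couplings differ by a local first-order operator -/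

/-- ★★ **The coupling enters the generator locally.**  For every `C²` function `f` of the real link coordinates whose pull-back `f∘coords` has
the link-Lipschitz profile `ℓ ≥ 0` (Frobenius distance, other links frozen), all couplings `β₁, β₂` and every configuration `V`:
`|𝓛_(β₁) f(V) − 𝓛_(β₂) f(V)| ≤ 2304π·|β₁ − β₂|·Σ_e ℓ_e`.  Frame form `𝓛_β f = ½Σ_n (W_nW_n f + W_nψ̂_β·W_n f)` (`generator_eq_half_frameGen`, the
second-order part is `β`-independent), `|W_n(ψ̂_(β₁) − ψ̂_(β₂))| ≤ √2·288π|β₁−β₂|` and `|W_n f| ≤ √2·ℓ_(n.1)` (`frameDeriv_abs_le_of_linkLipschitz`),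
`8` noise directions per link.  No volume factor: only the links where `f` varies contribute. [cite: ShenZhuZhu2022, §3 Lemma 3.1] -/
theorem abs_generator_sub_generator_le (L : ℕ) [NeZero L] (β₁ β₂ : ℝ) {f : (Edge 3 L × Fin 2 × Fin 2 × Bool → ℝ) → ℝ} (hf : ContDiff ℝ 2 f)
    {ℓ : Edge 3 L → ℝ} (hℓ : ∀ e, 0 ≤ ℓ e) (V : (GaugeConfig 3 L (Matrix.specialUnitaryGroup (Fin 2) ℂ))) :
    let coords : GaugeConfig 3 L (Matrix.specialUnitaryGroup (Fin 2) ℂ) → (Edge 3 L × Fin 2 × Fin 2 × Bool → ℝ) :=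
      fun V q => (fun z : ℂ => if q.2.2.2 then z.im else z.re)
        ((fundamentalRep (Fin 2) (V q.1) : Matrix (Fin 2) (Fin 2) ℂ) q.2.1 q.2.2.1)
    (∀ (e : Edge 3 L) (y y' : (GaugeConfig 3 L (Matrix.specialUnitaryGroup (Fin 2) ℂ))), (∀ f', f' ≠ e → y f' = y' f') →
      |f (coords y) - f (coords y')| ≤ ℓ e * frobNorm ((y e : Matrix (Fin 2) (Fin 2) ℂ) - (y' e : Matrix (Fin 2) (Fin 2) ℂ))) →
    |((∑ i : Edge 3 L × Fin 2 × Fin 2 × Bool, fderiv ℝ f (coords V) (Pi.single i 1) *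
          (fun z : ℂ => if i.2.2.2 then z.im else z.re)
            ((latticeLangevinDynamics (fundamentalLatticeRep 2) β₁).drift
              (matrixConfig (fundamentalRep (Fin 2)) V) i.1 i.2.1 i.2.2.1) +
      1 / 2 * ∑ i : Edge 3 L × Fin 2 × Fin 2 × Bool, ∑ j : Edge 3 L × Fin 2 × Fin 2 × Bool,
        fderiv ℝ (fun z => fderiv ℝ f z (Pi.single i 1)) (coords V) (Pi.single j 1) *
          ∑ n : Edge 3 L × NoiseIdx 2,
            (if n.1 = i.1 then (fun z : ℂ => if i.2.2.2 then z.im else z.re)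
              ((latticeLangevinDynamics (fundamentalLatticeRep 2) β₁).noise
                (matrixConfig (fundamentalRep (Fin 2)) V) i.1 n.2 i.2.1 i.2.2.1) else 0) *
            (if n.1 = j.1 then (fun z : ℂ => if j.2.2.2 then z.im else z.re)
              ((latticeLangevinDynamics (fundamentalLatticeRep 2) β₁).noise
                (matrixConfig (fundamentalRep (Fin 2)) V) j.1 n.2 j.2.1 j.2.2.1) else 0))) -
      ((∑ i : Edge 3 L × Fin 2 × Fin 2 × Bool, fderiv ℝ f (coords V) (Pi.single i 1) *
          (fun z : ℂ => if i.2.2.2 then z.im else z.re)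
            ((latticeLangevinDynamics (fundamentalLatticeRep 2) β₂).drift
              (matrixConfig (fundamentalRep (Fin 2)) V) i.1 i.2.1 i.2.2.1) +
      1 / 2 * ∑ i : Edge 3 L × Fin 2 × Fin 2 × Bool, ∑ j : Edge 3 L × Fin 2 × Fin 2 × Bool,
        fderiv ℝ (fun z => fderiv ℝ f z (Pi.single i 1)) (coords V) (Pi.single j 1) *
          ∑ n : Edge 3 L × NoiseIdx 2,
            (if n.1 = i.1 then (fun z : ℂ => if i.2.2.2 then z.im else z.re)
              ((latticeLangevinDynamics (fundamentalLatticeRep 2) β₂).noise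
                (matrixConfig (fundamentalRep (Fin 2)) V) i.1 n.2 i.2.1 i.2.2.1) else 0) *
            (if n.1 = j.1 then (fun z : ℂ => if j.2.2.2 then z.im else z.re)
              ((latticeLangevinDynamics (fundamentalLatticeRep 2) β₂).noise
                (matrixConfig (fundamentalRep (Fin 2)) V) j.1 n.2 j.2.1 j.2.2.1) else 0)))| ≤ 2304 * Real.pi * |β₁ - β₂| * ∑ e : Edge 3 L, ℓ e := by
  intro coords hLf
  classical
  obtain ⟨s, c, hs, -, -, -, hCas⟩ := exists_noiseFrame L
  have h1 : ((∑ i : Edge 3 L × Fin 2 × Fin 2 × Bool, fderiv ℝ f (coords V) (Pi.single i 1) *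
          (fun z : ℂ => if i.2.2.2 then z.im else z.re)
            ((latticeLangevinDynamics (fundamentalLatticeRep 2) β₁).drift
              (matrixConfig (fundamentalRep (Fin 2)) V) i.1 i.2.1 i.2.2.1) +
      1 / 2 * ∑ i : Edge 3 L × Fin 2 × Fin 2 × Bool, ∑ j : Edge 3 L × Fin 2 × Fin 2 × Bool,
        fderiv ℝ (fun z => fderiv ℝ f z (Pi.single i 1)) (coords V) (Pi.single j 1) *
          ∑ n : Edge 3 L × NoiseIdx 2,
            (if n.1 = i.1 then (fun z : ℂ => if i.2.2.2 then z.im else z.re)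
              ((latticeLangevinDynamics (fundamentalLatticeRep 2) β₁).noise
                (matrixConfig (fundamentalRep (Fin 2)) V) i.1 n.2 i.2.1 i.2.2.1) else 0) *
            (if n.1 = j.1 then (fun z : ℂ => if j.2.2.2 then z.im else z.re)
              ((latticeLangevinDynamics (fundamentalLatticeRep 2) β₁).noise
                (matrixConfig (fundamentalRep (Fin 2)) V) j.1 n.2 j.2.1 j.2.2.1) else 0))) =
      1 / 2 * ∑ n : Edge 3 L × NoiseIdx (fundamentalLatticeRep 2).N, (fderiv ℝ (fun w => fderiv ℝ f w (s n w)) (coords V) (s n (coords V)) + fderiv ℝ (fun y : (Edge 3 L × Fin (fundamentalLatticeRep 2).N × Fin (fundamentalLatticeRep 2).N × Bool → ℝ) => β₁ * ∑ p : Plaquette 3 L, (rootedLoop (fun (ee : Edge 3 L) (i j : Fin (fundamentalLatticeRep 2).N) => ((y (ee, i, j, false) : ℝ) : ℂ) + ((y (ee, i, j, true) : ℝ) : ℂ) * Complex.I) (p.1, p.2.1.1) p.2.1.2 false).trace.re) (coords V) (s n (coords V)) * fderiv ℝ f (coords V) (s n (coords V))) :=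
    generator_eq_half_frameGen L β₁ s hs hCas f hf V
  have h2 : ((∑ i : Edge 3 L × Fin 2 × Fin 2 × Bool, fderiv ℝ f (coords V) (Pi.single i 1) *
          (fun z : ℂ => if i.2.2.2 then z.im else z.re)
            ((latticeLangevinDynamics (fundamentalLatticeRep 2) β₂).drift
              (matrixConfig (fundamentalRep (Fin 2)) V) i.1 i.2.1 i.2.2.1) +
      1 / 2 * ∑ i : Edge 3 L × Fin 2 × Fin 2 × Bool, ∑ j : Edge 3 L × Fin 2 × Fin 2 × Bool,
        fderiv ℝ (fun z => fderiv ℝ f z (Pi.single i 1)) (coords V) (Pi.single j 1) *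
          ∑ n : Edge 3 L × NoiseIdx 2,
            (if n.1 = i.1 then (fun z : ℂ => if i.2.2.2 then z.im else z.re)
              ((latticeLangevinDynamics (fundamentalLatticeRep 2) β₂).noise
                (matrixConfig (fundamentalRep (Fin 2)) V) i.1 n.2 i.2.1 i.2.2.1) else 0) *
            (if n.1 = j.1 then (fun z : ℂ => if j.2.2.2 then z.im else z.re)
              ((latticeLangevinDynamics (fundamentalLatticeRep 2) β₂).noise
                (matrixConfig (fundamentalRep (Fin 2)) V) j.1 n.2 j.2.1 j.2.2.1) else 0))) =
      1 / 2 * ∑ n : Edge 3 L × NoiseIdx (fundamentalLatticeRep 2).N, (fderiv ℝ (fun w => fderiv ℝ f w (s n w)) (coords V) (s n (coords V)) + fderiv ℝ (fun y : (Edge 3 L × Fin (fundamentalLatticeRep 2).N × Fin (fundamentalLatticeRep 2).N × Bool → ℝ) => β₂ * ∑ p : Plaquette 3 L, (rootedLoop (fun (ee : Edge 3 L) (i j : Fin (fundamentalLatticeRep 2).N) => ((y (ee, i, j, false) : ℝ) : ℂ) + ((y (ee, i, j, true) : ℝ) : ℂ) * Complex.I) (p.1, p.2.1.1) p.2.1.2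 false).trace.re) (coords V) (s n (coords V)) * fderiv ℝ f (coords V) (s n (coords V))) :=
    generator_eq_half_frameGen L β₂ s hs hCas f hf V
  rw [h1, h2, ← mul_sub, ← Finset.sum_sub_distrib]
  -- the difference of the two density exponents
  set u : (Edge 3 L × Fin (fundamentalLatticeRep 2).N × Fin (fundamentalLatticeRep 2).N × Bool → ℝ) → ℝ :=
    (fun y : (Edge 3 L × Fin (fundamentalLatticeRep 2).N × Fin (fundamentalLatticeRep 2).N × Bool → ℝ) => β₁ * ∑ p : Plaquette 3 L, (rootedLoop (fun (ee : Edge 3 L) (i j : Fin (fundamentalLatticeRep 2).N) => ((y (ee, i, j, false) : ℝ) : ℂ) + ((y (ee, i, j, true) : ℝ) : ℂ) * Complex.I) (p.1, p.2.1.1) p.2.1.2 false).trace.re) - (fun y : (Edge 3 L × Fin (fundamentalLatticeRep 2).N × Fin (fundamentalLatticeRep 2).N × Bool → ℝ) => β₂ * ∑ p : Plaquette 3 L, (rootedLoop (fun (ee : Edge 3 L) (i j : Fin (fundamentalLatticeRep 2).N) => ((y (ee, i, j, false) : ℝ) : ℂ) + ((y (ee, i, j, true) : ℝ) : ℂ)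 * Complex.I) (p.1, p.2.1.1) p.2.1.2 false).trace.re) with hu
  have hψ1 : ContDiff ℝ 1 (fun y : (Edge 3 L × Fin (fundamentalLatticeRep 2).N × Fin (fundamentalLatticeRep 2).N × Bool → ℝ) => β₁ * ∑ p : Plaquette 3 L, (rootedLoop (fun (ee : Edge 3 L) (i j : Fin (fundamentalLatticeRep 2).N) => ((y (ee, i, j, false) : ℝ) : ℂ) + ((y (ee, i, j, true) : ℝ) : ℂ) * Complex.I) (p.1, p.2.1.1) p.2.1.2 false).trace.re) := contDiff_psiHat (d := 3) (L := L) (N := (fundamentalLatticeRep 2).N) (n := 1) β₁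
  have hψ2 : ContDiff ℝ 1 (fun y : (Edge 3 L × Fin (fundamentalLatticeRep 2).N × Fin (fundamentalLatticeRep 2).N × Bool → ℝ) => β₂ * ∑ p : Plaquette 3 L, (rootedLoop (fun (ee : Edge 3 L) (i j : Fin (fundamentalLatticeRep 2).N) => ((y (ee, i, j, false) : ℝ) : ℂ) + ((y (ee, i, j, true) : ℝ) : ℂ) * Complex.I) (p.1, p.2.1.1) p.2.1.2 false).trace.re) := contDiff_psiHat (d := 3) (L := L) (N := (fundamentalLatticeRep 2).N) (n := 1) β₂
  have huC : ContDiff ℝ 1 u := hψ1.sub hψ2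
  have hdu : ∀ (x v : Edge 3 L × Fin (fundamentalLatticeRep 2).N × Fin (fundamentalLatticeRep 2).N × Bool → ℝ),
      fderiv ℝ u x v = fderiv ℝ (fun y : (Edge 3 L × Fin (fundamentalLatticeRep 2).N × Fin (fundamentalLatticeRep 2).N × Bool → ℝ) => β₁ * ∑ p : Plaquette 3 L, (rootedLoop (fun (ee : Edge 3 L) (i j : Fin (fundamentalLatticeRep 2).N) => ((y (ee, i, j, false) : ℝ) : ℂ) + ((y (ee, i, j, true) : ℝ) : ℂ) * Complex.I) (p.1, p.2.1.1) p.2.1.2 false).trace.re) x v - fderiv ℝ (fun y : (Edge 3 L × Fin (fundamentalLatticeRep 2).N × Fin (fundamentalLatticeRep 2).N × Bool → ℝ) => β₂ * ∑ p : Plaquette 3 L, (rootedLoop (fun (ee : Edge 3 L) (i j : Fin (fundamentalLatticeRep 2).N) => ((y (ee, i, j, false) : ℝ) : ℂ) + ((y (ee, i, j, true) : ℝ) : ℂ) * Complex.I) (p.1, p.2.1.1) p.2.1.2 false).trace.re) x v := by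
    intro x v
    rw [hu, fderiv_sub ((hψ1.differentiable (by norm_num)).differentiableAt) ((hψ2.differentiable (by norm_num)).differentiableAt),
      _root_.sub_apply]
  -- each summand: `(W_nψ̂₁ − W_nψ̂₂)·W_n f = W_n u · W_n f`
  have hterm : ∀ n : Edge 3 L × NoiseIdx (fundamentalLatticeRep 2).N,
      (fderiv ℝ (fun w => fderiv ℝ f w (s n w)) (coords V) (s n (coords V)) + fderiv ℝ (fun y : (Edge 3 L × Fin (fundamentalLatticeRep 2).N × Fin (fundamentalLatticeRep 2).N × Bool → ℝ) => β₁ * ∑ p : Plaquette 3 L, (rootedLoop (fun (ee : Edge 3 L) (i j : Fin (fundamentalLatticeRep 2).N) => ((y (ee, i, j, false) : ℝ) : ℂ) + ((y (ee, i, j, true) : ℝ) : ℂ) * Complex.I) (p.1, p.2.1.1) p.2.1.2 false).trace.re) (coords V) (s n (coords V)) * fderiv ℝ f (coords V) (s n (coords V))) -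
      (fderiv ℝ (fun w => fderiv ℝ f w (s n w)) (coords V) (s n (coords V)) + fderiv ℝ (fun y : (Edge 3 L × Fin (fundamentalLatticeRep 2).N × Fin (fundamentalLatticeRep 2).N × Bool → ℝ) => β₂ * ∑ p : Plaquette 3 L, (rootedLoop (fun (ee : Edge 3 L) (i j : Fin (fundamentalLatticeRep 2).N) => ((y (ee, i, j, false) : ℝ) : ℂ) + ((y (ee, i, j, true) : ℝ) : ℂ) * Complex.I) (p.1, p.2.1.1) p.2.1.2 false).trace.re) (coords V) (s n (coords V)) * fderiv ℝ f (coords V) (s n (coords V))) =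
      fderiv ℝ u (coords V) (s n (coords V)) * fderiv ℝ f (coords V) (s n (coords V)) := by
    intro n; rw [hdu]; ring
  simp_rw [hterm]
  -- frame derivative bounds
  have hLu : ∀ (n : Edge 3 L × NoiseIdx (fundamentalLatticeRep 2).N) (y y' : (GaugeConfig 3 L (Matrix.specialUnitaryGroup (Fin 2) ℂ))), (∀ f', f' ≠ n.1 → y f' = y' f') →
      |u (coords y) - u (coords y')| ≤ (288 * Real.pi * |β₁ - β₂|) * frobNorm ((y n.1 : Matrix (Fin 2) (Fin 2) ℂ) - (y' n.1 : Matrix (Fin 2) (Fin 2) ℂ)) :=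
    fun n y y' h => abs_psiHat_sub_psiHat_sub_le (L := L) β₁ β₂ n.1 y y' h
  have hWu : ∀ n : Edge 3 L × NoiseIdx (fundamentalLatticeRep 2).N, |fderiv ℝ u (coords V) (s n (coords V))| ≤ Real.sqrt 2 * (288 * Real.pi * |β₁ - β₂|) := by
    intro n
    rw [hs n (coords V)]
    exact frameDeriv_abs_le_of_linkLipschitz huC n (by positivity) (fun y y' h => hLu n y y' h) V
  have hWf : ∀ n : Edge 3 L × NoiseIdx (fundamentalLatticeRep 2).N, |fderiv ℝ f (coords V) (s n (coords V))| ≤ Real.sqrt 2 * ℓ n.1 := by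
    intro n
    rw [hs n (coords V)]
    exact frameDeriv_abs_le_of_linkLipschitz (hf.of_le (by norm_num)) n (hℓ n.1) (fun y y' h => hLf n.1 y y' h) V
  have hprod : ∀ n : Edge 3 L × NoiseIdx (fundamentalLatticeRep 2).N,
      |fderiv ℝ u (coords V) (s n (coords V)) * fderiv ℝ f (coords V) (s n (coords V))| ≤ 2 * (288 * Real.pi * |β₁ - β₂|) * ℓ n.1 := by
    intro n
    rw [abs_mul]
    have hs2 : Real.sqrt 2 * Real.sqrt 2 = 2 := Real.mul_self_sqrt (by norm_num)
    calc |fderiv ℝ u (coords V) (s n (coords V))| * |fderiv ℝ f (coords V) (s n (coords V))|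
        ≤ (Real.sqrt 2 * (288 * Real.pi * |β₁ - β₂|)) * (Real.sqrt 2 * ℓ n.1) :=
          mul_le_mul (hWu n) (hWf n) (abs_nonneg _) (by positivity)
      _ = (Real.sqrt 2 * Real.sqrt 2) * (288 * Real.pi * |β₁ - β₂|) * ℓ n.1 := by ring
      _ = 2 * (288 * Real.pi * |β₁ - β₂|) * ℓ n.1 := by rw [hs2]
  have hcard8 : Fintype.card (NoiseIdx (fundamentalLatticeRep 2).N) = 8 := by
    rw [Literature.MathematicalPhysics.QuantumLattice.fundamentalLatticeRep_N]; rfl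
  rw [abs_mul, abs_of_pos (by norm_num : (0 : ℝ) < 1 / 2)]
  calc 1 / 2 * |∑ n : Edge 3 L × NoiseIdx (fundamentalLatticeRep 2).N, fderiv ℝ u (coords V) (s n (coords V)) * fderiv ℝ f (coords V) (s n (coords V))|
      ≤ 1 / 2 * ∑ n : Edge 3 L × NoiseIdx (fundamentalLatticeRep 2).N, |fderiv ℝ u (coords V) (s n (coords V)) * fderiv ℝ f (coords V) (s n (coords V))| :=
        mul_le_mul_of_nonneg_left (Finset.abs_sum_le_sum_abs _ _) (by norm_num)
    _ ≤ 1 / 2 * ∑ n : Edge 3 L × NoiseIdx (fundamentalLatticeRep 2).N, 2 * (288 * Real.pi * |β₁ - β₂|) * ℓ n.1 :=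
        mul_le_mul_of_nonneg_left (Finset.sum_le_sum fun n _ => hprod n) (by norm_num)
    _ = 1 / 2 * ∑ e : Edge 3 L, ∑ _ν : NoiseIdx (fundamentalLatticeRep 2).N, 2 * (288 * Real.pi * |β₁ - β₂|) * ℓ e := by rw [Fintype.sum_prod_type]
    _ = 1 / 2 * ∑ e : Edge 3 L, 8 * (2 * (288 * Real.pi * |β₁ - β₂|) * ℓ e) := by
        congr 1
        refine Finset.sum_congr rfl fun e _ => ?_
        rw [Finset.sum_const, Finset.card_univ, hcard8, nsmul_eq_mul]
        push_cast; ring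
    _ = 2304 * Real.pi * |β₁ - β₂| * ∑ e : Edge 3 L, ℓ e := by rw [Finset.mul_sum, Finset.mul_sum]; exact Finset.sum_congr rfl fun e _ => by ring

end Summit.QuantumFields.YangMills.Theorems.ColdStartUniversality.LiebRobinson

end
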